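import Mathlib.Tactic.Linarith
import Summits.CriticalPhenomena.PercolationContinuityZ3.Theorems.PercNearOneGluingNoHeavyLowerTailSahiCTCReduction
import Summits.CriticalPhenomena.PercolationContinuityZ3.Theorems.PercNearOneGluingNoHeavyLowerTailSahiCTCGroundBlocks
import HarnessLib

/-!
# `NoHeavyLowerTail` (crux stmt-CriticalPhenomena-4575), P3 lane: the generic c = 2 certificate polynomial `Ñ₂ = N2gen` is
# ANTITONE for GENERAL pairs of complexes (big faces, private small faces), and its NORMAL-FORM REDUCTION to flag configurations

Support file (seat `prim-l12-p3`, gen 20; `--supports stmt-CriticalPhenomena-4575`).  Companion of `…SahiCTCReduction` (which treats the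
closed forms `G022/G122/G222` on ALL-LIVE pairs).  Memo `run/shared/lean/prim/prim-l12/FROM-prim-l12-p3-g20-*.md`.

For ARBITRARY families `K_X, K_Z` (no liveness assumption) the polynomial `N2gen K_X K_Z` of `…SahiCTCReduction` (g9's form (A) of the
`(TC)` row of the c = 2 threshold certificate) satisfies two exact increment identities when one set `S` is removed from `K_X`:
* `#S ≥ 3`:  `Ñ₂(K_X∖S, K_Z) = Ñ₂(K_X, K_Z) + e₂·r^S·(D·h_Z − Θ·t_Z)` (`N2gen_erase_big`), and `D·h_Z − Θ·t_Z ∈ ℕ[r]` for every down-set `K_Z`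
  by weighted LYM across the level classes `{≤ 2} < {≥ 3}` (`coeff_lymClass2_sub_nonneg`);
* `#S ≤ 2`, `S ∉ K_Z`:  `Ñ₂(K_X∖S, K_Z) = Ñ₂(K_X, K_Z) + e₂·r^S·((Π+D)·h_Z + D·t_Z)` (`N2gen_erase_small`), manifestly in `ℕ[r]`.
Hence (`coeff_N2gen_antitone_left/right`) enlarging `K_X` by big sets and by small sets that are not faces of `K_Z` can only LOWER `Ñ₂`
coefficientwise.  Consequently (`coeff_N2gen_nf_le`) every pair of down-sets containing `∅` dominates coefficientwise its NORMAL FORM: the pair of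
flag complexes `(Fl(L_X, E_X), Fl(L_Z, E_Z))` with `L_X ∪ L_Z = univ` (doubly-dead vertices made `X`-live), all private pairs present, and the pairs
inside `L_X ∩ L_Z` 3-coloured (`X`-only ⊇ the pairs in neither complex, `Z`-only, both).  `coeff_N2gen_nonneg_of_configs` packages this:
nonnegativity of `Ñ₂` on all such flag configurations implies `Ñ₂ ∈ ℕ[r]` for every pair of complexes.  This is the reduction behind the finite
kernel check on `Fin 5` (`…SahiCTCN2Fin*`).  Nothing is asserted about the crux; no positivity is claimed here.
-/

namespace Summit.CriticalPhenomena.PercolationContinuityZ3.Theorems.SahiCTCForms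

open Finset MvPolynomial SahiCTCGenFun

variable {α : Type*} [DecidableEq α] [Fintype α]

/-! ### Symmetry and the level-class LYM inequality -/

/-- `h_Y` is symmetric. [this work] -/
theorem smallCommonFaces_comm (KX KZ : Finset (Finset α)) : smallCommonFaces KX KZ = smallCommonFaces KZ KX := by
  ext S; simp only [smallCommonFaces, mem_filter]; tauto

/-- `Ñ₂` is symmetric under `X ↔ Z`. [this work] -/
theorem N2gen_comm (KX KZ : Finset (Finset α)) : N2gen KX KZ = N2gen KZ KX := by
  unfold N2gen; rw [smallCommonFaces_comm KZ KX, commonEdges_comm KZ KX]; ring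

/-- `h_K` as a filter of `K`. [this work] -/
theorem smallFaces_eq_filter (K : Finset (Finset α)) : smallFaces K = K.filter fun S => #S ≤ 2 := by
  ext S; simp only [smallFaces, mem_filter, mem_powerset]
  exact ⟨fun h => ⟨h.2.2, h.2.1⟩, fun h => ⟨subset_univ _, h.2, h.1⟩⟩

/-- `t_K` as a filter of `K`. [this work] -/
theorem bigFaces_eq_filter (K : Finset (Finset α)) : bigFaces K = K.filter fun S => 3 ≤ #S := by
  ext S; simp only [bigFaces, mem_filter, mem_powerset]
  exact ⟨fun h => ⟨h.2.2, h.2.1⟩, fun h => ⟨subset_univ _, h.2, h.1⟩⟩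

/-- **Weighted LYM across the classes `{≤ 2} < {≥ 3}`**: for a down-set `K`, `D·h_K − Θ·t_K ∈ ℕ[r]` (`D` = all sets of size `≥ 3`, `Θ` = all sets
of size `≤ 2`, `h_K`/`t_K` the faces of size `≤ 2`/`≥ 3`).  Sum of the single-level blocks `coeff_downLYM_sub_nonneg`. [this work] -/
theorem coeff_lymClass2_sub_nonneg {K : Finset (Finset α)} (hK : IsLowerSet (K : Set (Finset α))) (n : α →₀ ℕ) :
    0 ≤ (Dd * gf (smallFaces K) - Th * gf (bigFaces K) : MvPolynomial α ℤ).coeff n := by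
  have hKV : ∀ S ∈ K, S ⊆ (univ : Finset α) := fun S _ => subset_univ S
  have hVV : ∀ S ∈ (univ : Finset α).powerset, S ⊆ (univ : Finset α) := fun S _ => subset_univ S
  set R := range (#(univ : Finset α) + 1) with hR
  have e1 : (Dd : MvPolynomial α ℤ) = ∑ j ∈ R.filter (fun j => 3 ≤ j), gf (univ.powerset.filter fun P : Finset α => #P = j) := by
    unfold Dd bySize; exact gf_filter_card_eq_sum hVV (fun j => 3 ≤ j)
  have e2 : gf (smallFaces K) = ∑ c ∈ R.filter (fun c => c ≤ 2), gf (K.filter fun S => #S = c) := by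
    rw [smallFaces_eq_filter]; exact gf_filter_card_eq_sum hKV (fun c => c ≤ 2)
  have e3 : (Th : MvPolynomial α ℤ) = ∑ c ∈ R.filter (fun c => c ≤ 2), gf (univ.powerset.filter fun P : Finset α => #P = c) := by
    unfold Th bySize; exact gf_filter_card_eq_sum hVV (fun c => c ≤ 2)
  have e4 : gf (bigFaces K) = ∑ j ∈ R.filter (fun j => 3 ≤ j), gf (K.filter fun S => #S = j) := by
    rw [bigFaces_eq_filter]; exact gf_filter_card_eq_sum hKV (fun j => 3 ≤ j)
  rw [e1, e2, e3, e4, sum_mul_sum, sum_mul_sum, sum_comm (s := R.filter (fun c => c ≤ 2)), ← sum_sub_distrib, coeff_sum]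
  refine sum_nonneg fun j hj => ?_
  rw [← sum_sub_distrib, coeff_sum]
  refine sum_nonneg fun c hc => ?_
  have hj2 := (mem_filter.1 hj).2
  have hc1 := (mem_filter.1 hc).2
  exact coeff_downLYM_sub_nonneg hK (show c ≤ j by omega) n

/-! ### Increment identities of `Ñ₂` under removal of one set from `K_X` -/

/-- Removing a big set does not change `h_K`. [this work] -/
theorem smallFaces_erase_big {K : Finset (Finset α)} {S : Finset α} (hS : 3 ≤ #S) : smallFaces (K.erase S) = smallFaces K := by
  ext T; simp only [smallFaces, mem_filter, mem_erase, ne_eq]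
  constructor
  · rintro ⟨h1, h2, _, h3⟩; exact ⟨h1, h2, h3⟩
  · rintro ⟨h1, h2, h3⟩; exact ⟨h1, h2, by rintro rfl; omega, h3⟩

/-- Removing a big face `S` removes exactly `S` from `t_K`. [this work] -/
theorem bigFaces_erase_big {K : Finset (Finset α)} {S : Finset α} (hSK : S ∈ K) (hS : 3 ≤ #S) :
    bigFaces (K.erase S) = (bigFaces K).erase S ∧ S ∈ bigFaces K := by
  refine ⟨?_, mem_filter.2 ⟨mem_powerset.2 (subset_univ _), hS, hSK⟩⟩
  ext T; simp only [bigFaces, mem_filter, mem_erase, ne_eq]; tauto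

/-- Removing a big set does not change `h_Y`. [this work] -/
theorem smallCommonFaces_erase_big {K KZ : Finset (Finset α)} {S : Finset α} (hS : 3 ≤ #S) :
    smallCommonFaces (K.erase S) KZ = smallCommonFaces K KZ := by
  ext T; simp only [smallCommonFaces, mem_filter, mem_erase, ne_eq]
  constructor
  · rintro ⟨h1, h2, ⟨_, h3⟩, h4⟩; exact ⟨h1, h2, h3, h4⟩
  · rintro ⟨h1, h2, h3, h4⟩; exact ⟨h1, h2, ⟨by rintro rfl; omega, h3⟩, h4⟩

/-- **Big-set increment**: for `S ∈ K_X` with `#S ≥ 3`, `Ñ₂(K_X∖S, K_Z) = Ñ₂(K_X, K_Z) + e₂·r^S·(D·h_Z − Θ·t_Z)`. [this work] -/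
theorem N2gen_erase_big {K KZ : Finset (Finset α)} {S : Finset α} (hSK : S ∈ K) (hS : 3 ≤ #S) :
    N2gen (K.erase S) KZ = N2gen K KZ + ee 2 * monomial (ind S) 1 * (Dd * gf (smallFaces KZ) - Th * gf (bigFaces KZ)) := by
  obtain ⟨h1, h2⟩ := bigFaces_erase_big hSK hS
  obtain ⟨_, _, h3⟩ := pairFamilies_erase (KX := K) (KZ := KZ) hS
  have hgf : gf (bigFaces K) = gf (bigFaces (K.erase S)) + monomial (ind S) 1 := by
    rw [h1]; unfold gf; rw [sum_erase_add _ _ h2]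
  unfold N2gen
  rw [smallFaces_erase_big hS, smallCommonFaces_erase_big hS, h3, hgf]
  ring

/-- Removing a small set `S ∈ K` removes exactly `S` from `h_K`. [this work] -/
theorem smallFaces_erase_small {K : Finset (Finset α)} {S : Finset α} (hSK : S ∈ K) (hS : #S ≤ 2) :
    smallFaces (K.erase S) = (smallFaces K).erase S ∧ S ∈ smallFaces K := by
  refine ⟨?_, mem_filter.2 ⟨mem_powerset.2 (subset_univ _), hS, hSK⟩⟩
  ext T; simp only [smallFaces, mem_filter, mem_erase, ne_eq]; tauto

/-- Removing a small set does not change `t_K`. [this work] -/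
theorem bigFaces_erase_small {K : Finset (Finset α)} {S : Finset α} (hS : #S ≤ 2) : bigFaces (K.erase S) = bigFaces K := by
  ext T; simp only [bigFaces, mem_filter, mem_erase, ne_eq]
  constructor
  · rintro ⟨h1, h2, _, h3⟩; exact ⟨h1, h2, h3⟩
  · rintro ⟨h1, h2, h3⟩; exact ⟨h1, h2, by rintro rfl; omega, h3⟩

/-- Removing a set that is not in `K_Z` does not change `h_Y`, `E_Y`. [this work] -/
theorem commonFamilies_erase_of_notMem {K KZ : Finset (Finset α)} {S : Finset α} (hSZ : S ∉ KZ) :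
    smallCommonFaces (K.erase S) KZ = smallCommonFaces K KZ ∧ commonEdges (K.erase S) KZ = commonEdges K KZ := by
  constructor
  · ext T; simp only [smallCommonFaces, mem_filter, mem_erase, ne_eq]
    constructor
    · rintro ⟨h1, h2, ⟨_, h3⟩, h4⟩; exact ⟨h1, h2, h3, h4⟩
    · rintro ⟨h1, h2, h3, h4⟩; exact ⟨h1, h2, ⟨by rintro rfl; exact hSZ h4, h3⟩, h4⟩
  · ext T; simp only [commonEdges, mem_filter, mem_erase, ne_eq]
    constructor
    · rintro ⟨h1, h2, ⟨_, h3⟩, h4⟩; exact ⟨h1, h2, h3, h4⟩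
    · rintro ⟨h1, h2, h3, h4⟩; exact ⟨h1, h2, ⟨by rintro rfl; exact hSZ h4, h3⟩, h4⟩

/-- **Small-set increment**: for `S ∈ K_X` with `#S ≤ 2` and `S ∉ K_Z`, `Ñ₂(K_X∖S, K_Z) = Ñ₂(K_X, K_Z) + e₂·r^S·((Π+D)·h_Z + D·t_Z)`. [this work] -/
theorem N2gen_erase_small {K KZ : Finset (Finset α)} {S : Finset α} (hSK : S ∈ K) (hS : #S ≤ 2) (hSZ : S ∉ KZ) :
    N2gen (K.erase S) KZ = N2gen K KZ + ee 2 * monomial (ind S) 1 * ((PiP + Dd) * gf (smallFaces KZ) + Dd * gf (bigFaces KZ)) := by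
  obtain ⟨h1, h2⟩ := smallFaces_erase_small hSK hS
  obtain ⟨h3, h4⟩ := commonFamilies_erase_of_notMem (K := K) hSZ
  have hgf : gf (smallFaces K) = gf (smallFaces (K.erase S)) + monomial (ind S) 1 := by
    rw [h1]; unfold gf; rw [sum_erase_add _ _ h2]
  unfold N2gen
  rw [bigFaces_erase_small hS, h3, h4, hgf]
  ring

/-- **One allowed removal raises `Ñ₂` coefficientwise**: `K_Z` a down-set, `S ∈ K_X` big or not a face of `K_Z`. [this work] -/
theorem coeff_N2gen_le_erase {K KZ : Finset (Finset α)} (hKZ : IsLowerSet (KZ : Set (Finset α))) {S : Finset α} (hSK : S ∈ K)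
    (h : 3 ≤ #S ∨ S ∉ KZ) (n : α →₀ ℕ) : (N2gen K KZ).coeff n ≤ (N2gen (K.erase S) KZ).coeff n := by
  have he2 : ∀ m, 0 ≤ (ee 2 : MvPolynomial α ℤ).coeff m := fun m => by unfold ee; exact coeff_gf_nonneg _ m
  by_cases hS : 3 ≤ #S
  · rw [N2gen_erase_big hSK hS, mul_assoc, coeff_add]
    have := coeff_mul_nonneg he2 (coeff_monomial_mul_nonneg S (coeff_lymClass2_sub_nonneg hKZ)) n
    linarith
  · have hS2 : #S ≤ 2 := by omega
    have hSZ : S ∉ KZ := h.resolve_left hS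
    rw [N2gen_erase_small hSK hS2 hSZ, mul_assoc, coeff_add]
    have hPi : ∀ m, 0 ≤ (PiP : MvPolynomial α ℤ).coeff m := fun m => by unfold PiP; exact coeff_gf_nonneg _ m
    have hDd : ∀ m, 0 ≤ (Dd : MvPolynomial α ℤ).coeff m := fun m => by unfold Dd; exact coeff_gf_nonneg _ m
    have hB : ∀ m, 0 ≤ ((PiP + Dd) * gf (smallFaces KZ) + Dd * gf (bigFaces KZ) : MvPolynomial α ℤ).coeff m :=
      cw_add (cw_mul (cw_add hPi hDd) (coeff_gf_nonneg _)) (cw_mul hDd (coeff_gf_nonneg _))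
    have := coeff_mul_nonneg he2 (coeff_monomial_mul_nonneg S hB) n
    linarith

/-- **`Ñ₂` is antitone in `K_X` along allowed enlargements**: if `K_Z` is a down-set, `K_X⁰ ⊆ K_X` and every set of `K_X ∖ K_X⁰` has size
`≥ 3` or is not in `K_Z`, then `Ñ₂(K_X, K_Z) ≤ Ñ₂(K_X⁰, K_Z)` coefficientwise. [this work] -/
theorem coeff_N2gen_antitone_left {KZ : Finset (Finset α)} (hKZ : IsLowerSet (KZ : Set (Finset α))) :
    ∀ (k : ℕ) (KX₀ KX : Finset (Finset α)), #(KX \ KX₀) = k → KX₀ ⊆ KX → (∀ S ∈ KX, S ∉ KX₀ → 3 ≤ #S ∨ S ∉ KZ) →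
      ∀ n : α →₀ ℕ, (N2gen KX KZ).coeff n ≤ (N2gen KX₀ KZ).coeff n := by
  intro k
  induction k with
  | zero =>
    intro KX₀ KX hk hsub _ n
    have : KX = KX₀ := Subset.antisymm (Finset.sdiff_eq_empty_iff_subset.1 (card_eq_zero.1 hk)) hsub
    rw [this]
  | succ k ih =>
    intro KX₀ KX hk hsub hdiff n
    obtain ⟨S, hS⟩ : (KX \ KX₀).Nonempty := card_pos.1 (by omega)
    obtain ⟨hSK, hS0⟩ := mem_sdiff.1 hS
    have hstep := coeff_N2gen_le_erase hKZ hSK (hdiff S hSK hS0) n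
    have hk' : #(KX.erase S \ KX₀) = k := by
      have : KX.erase S \ KX₀ = (KX \ KX₀).erase S := by ext T; simp only [mem_sdiff, mem_erase]; tauto
      rw [this, card_erase_of_mem hS, hk]; rfl
    have hsub' : KX₀ ⊆ KX.erase S := fun T hT => mem_erase.2 ⟨fun h => hS0 (h ▸ hT), hsub hT⟩
    have hdiff' : ∀ T ∈ KX.erase S, T ∉ KX₀ → 3 ≤ #T ∨ T ∉ KZ := fun T hT hT0 => hdiff T (mem_of_mem_erase hT) hT0
    exact hstep.trans (ih KX₀ (KX.erase S) hk' hsub' hdiff' n)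

/-- Antitonicity in `K_Z` (by the symmetry `N2gen_comm`), `K_X` a down-set. [this work] -/
theorem coeff_N2gen_antitone_right {KX KZ₀ KZ : Finset (Finset α)} (hKX : IsLowerSet (KX : Set (Finset α))) (hsub : KZ₀ ⊆ KZ)
    (hdiff : ∀ S ∈ KZ, S ∉ KZ₀ → 3 ≤ #S ∨ S ∉ KX) (n : α →₀ ℕ) :
    (N2gen KX KZ).coeff n ≤ (N2gen KX KZ₀).coeff n := by
  rw [N2gen_comm KX KZ, N2gen_comm KX KZ₀]
  exact coeff_N2gen_antitone_left hKX _ KZ₀ KZ rfl hsub hdiff n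

/-! ### Flag configurations and the normal form -/

/-- The flag complex on the live set `L` with edge set `E`: the subsets of `L` all of whose 2-subsets lie in `E`. [this work] -/
def flagCx (L : Finset α) (E : Finset (Finset α)) : Finset (Finset α) :=
  univ.powerset.filter fun S => S ⊆ L ∧ ∀ e ∈ S.powerset, #e = 2 → e ∈ E

/-- The 2-subsets of `B`. [this work] -/
def pairsIn (B : Finset α) : Finset (Finset α) := univ.powerset.filter fun e => #e = 2 ∧ e ⊆ B

/-- The private pairs of `L` with respect to `L'`: 2-subsets of `L` not inside `L'`. [this work] -/
def privPairs (L L' : Finset α) : Finset (Finset α) := univ.powerset.filter fun e => #e = 2 ∧ e ⊆ L ∧ ¬ e ⊆ L'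

/-- Membership in a flag complex. [this work] -/
theorem mem_flagCx {L : Finset α} {E : Finset (Finset α)} {S : Finset α} :
    S ∈ flagCx L E ↔ S ⊆ L ∧ ∀ e, e ⊆ S → #e = 2 → e ∈ E := by
  simp only [flagCx, mem_filter, mem_powerset, subset_univ, true_and]

/-- A flag complex is a down-set. [this work] -/
theorem isLowerSet_flagCx (L : Finset α) (E : Finset (Finset α)) : IsLowerSet ((flagCx L E : Finset (Finset α)) : Set (Finset α)) := by
  intro S T hTS hS
  rw [mem_coe, mem_flagCx] at hS ⊢
  exact ⟨hTS.trans hS.1, fun e he h2 => hS.2 e (he.trans hTS) h2⟩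

section nf
variable (KX KZ : Finset (Finset α))

/-- Normal-form live set of `X`: the `X`-live vertices together with the doubly-dead ones. [this work] -/
def nfLX : Finset α := univ.filter fun v => {v} ∈ KX ∨ {v} ∉ KZ

/-- Normal-form live set of `Z`: the `Z`-live vertices. [this work] -/
def nfLZ : Finset α := univ.filter fun v => {v} ∈ KZ

/-- Normal-form `X`-edges inside the common live set: the pairs in `K_X` or not in `K_Z`. [this work] -/
def nfA : Finset (Finset α) := (pairsIn (nfLX KX KZ ∩ nfLZ KZ)).filter fun e => e ∈ KX ∨ e ∉ KZ

/-- Normal-form `Z`-edges inside the common live set: the pairs in `K_Z`. [this work] -/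
def nfB : Finset (Finset α) := (pairsIn (nfLX KX KZ ∩ nfLZ KZ)).filter fun e => e ∈ KZ

/-- The normal-form `X`-complex. [this work] -/
def nfX : Finset (Finset α) := flagCx (nfLX KX KZ) (privPairs (nfLX KX KZ) (nfLZ KZ) ∪ nfA KX KZ)

/-- The normal-form `Z`-complex. [this work] -/
def nfZ : Finset (Finset α) := flagCx (nfLZ KZ) (privPairs (nfLZ KZ) (nfLX KX KZ) ∪ nfB KX KZ)

/-- The normal form is a valid flag configuration: `L_X ∪ L_Z = univ`, `A, B ⊆ pairs(L_X ∩ L_Z) ⊆ A ∪ B`. [this work] -/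
theorem nf_valid : nfLX KX KZ ∪ nfLZ KZ = univ ∧ nfA KX KZ ⊆ pairsIn (nfLX KX KZ ∩ nfLZ KZ) ∧ nfB KX KZ ⊆ pairsIn (nfLX KX KZ ∩ nfLZ KZ) ∧
    pairsIn (nfLX KX KZ ∩ nfLZ KZ) ⊆ nfA KX KZ ∪ nfB KX KZ := by
  refine ⟨?_, filter_subset _ _, filter_subset _ _, fun e he => ?_⟩
  · ext v; simp only [nfLX, nfLZ, mem_union, mem_filter, mem_univ, true_and, iff_true]; tauto
  · rw [mem_union, nfA, nfB, mem_filter, mem_filter]; tauto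

variable {KX KZ}

omit [DecidableEq α] [Fintype α] in
/-- A down-set containing a set contains its singletons. [this work] -/
theorem singleton_mem_of_mem {K : Finset (Finset α)} (hK : IsLowerSet (K : Set (Finset α))) {S : Finset α} (hS : S ∈ K) {v : α} (hv : v ∈ S) :
    {v} ∈ K := hK (singleton_subset_iff.2 hv) hS

/-- `K_X ⊆` its normal form, for down-sets. [this work] -/
theorem subset_nfX (hKX : IsLowerSet (KX : Set (Finset α))) : KX ⊆ nfX KX KZ := by
  intro S hS
  rw [nfX, mem_flagCx]
  have hL : S ⊆ nfLX KX KZ := fun v hv => mem_filter.2 ⟨mem_univ _, Or.inl (singleton_mem_of_mem hKX hS hv)⟩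
  refine ⟨hL, fun e he h2 => ?_⟩
  have heK : e ∈ KX := hKX he hS
  by_cases heZ : e ⊆ nfLZ KZ
  · exact mem_union_right _ (mem_filter.2 ⟨mem_filter.2 ⟨mem_powerset.2 (subset_univ _), h2, subset_inter (he.trans hL) heZ⟩, Or.inl heK⟩)
  · exact mem_union_left _ (mem_filter.2 ⟨mem_powerset.2 (subset_univ _), h2, he.trans hL, heZ⟩)

/-- The sets added to `K_X` by the normal form are big or not faces of `K_Z`. [this work] -/
theorem nfX_diff (h0X : ∅ ∈ KX) (hKZ : IsLowerSet (KZ : Set (Finset α))) :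
    ∀ S ∈ nfX KX KZ, S ∉ KX → 3 ≤ #S ∨ S ∉ KZ := by
  intro S hS hSX
  by_cases h3 : 3 ≤ #S
  · exact Or.inl h3
  refine Or.inr fun hSZ => ?_
  rw [nfX, mem_flagCx] at hS
  rcases Nat.lt_or_ge #S 1 with h0 | h1
  · have hS0 : S = ∅ := card_eq_zero.1 (by omega)
    subst hS0; exact hSX h0X
  rcases Nat.lt_or_ge #S 2 with h1' | h2
  · obtain ⟨v, rfl⟩ := card_eq_one.1 (show #S = 1 by omega)
    have hv := (mem_filter.1 (hS.1 (mem_singleton_self v))).2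
    tauto
  · have hS2 : #S = 2 := by omega
    rcases mem_union.1 (hS.2 S Subset.rfl hS2) with h | h
    · obtain ⟨_, _, _, hnz⟩ := mem_filter.1 h
      exact hnz fun v hv => mem_filter.2 ⟨mem_univ _, singleton_mem_of_mem hKZ hSZ hv⟩
    · have := (mem_filter.1 h).2; tauto

/-- `K_Z ⊆` its normal form, for down-sets. [this work] -/
theorem subset_nfZ (hKZ : IsLowerSet (KZ : Set (Finset α))) : KZ ⊆ nfZ KX KZ := by
  intro S hS
  rw [nfZ, mem_flagCx]
  have hL : S ⊆ nfLZ KZ := fun v hv => mem_filter.2 ⟨mem_univ _, singleton_mem_of_mem hKZ hS hv⟩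
  refine ⟨hL, fun e he h2 => ?_⟩
  have heK : e ∈ KZ := hKZ he hS
  by_cases heX : e ⊆ nfLX KX KZ
  · exact mem_union_right _ (mem_filter.2 ⟨mem_filter.2 ⟨mem_powerset.2 (subset_univ _), h2, subset_inter heX (he.trans hL)⟩, heK⟩)
  · exact mem_union_left _ (mem_filter.2 ⟨mem_powerset.2 (subset_univ _), h2, he.trans hL, heX⟩)

/-- The sets added to `K_Z` by the normal form are big or not faces of the normal-form `X`-complex. [this work] -/
theorem nfZ_diff (h0Z : ∅ ∈ KZ) : ∀ S ∈ nfZ KX KZ, S ∉ KZ → 3 ≤ #S ∨ S ∉ nfX KX KZ := by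
  intro S hS hSZ
  by_cases h3 : 3 ≤ #S
  · exact Or.inl h3
  refine Or.inr fun hSX => ?_
  rw [nfZ, mem_flagCx] at hS
  rw [nfX, mem_flagCx] at hSX
  rcases Nat.lt_or_ge #S 1 with h0 | h1
  · have hS0 : S = ∅ := card_eq_zero.1 (by omega)
    subst hS0; exact hSZ h0Z
  rcases Nat.lt_or_ge #S 2 with h1' | h2
  · obtain ⟨v, rfl⟩ := card_eq_one.1 (show #S = 1 by omega)
    exact hSZ (mem_filter.1 (hS.1 (mem_singleton_self v))).2
  · have hS2 : #S = 2 := by omega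
    rcases mem_union.1 (hS.2 S Subset.rfl hS2) with h | h
    · exact (mem_filter.1 h).2.2.2 hSX.1
    · exact hSZ (mem_filter.1 h).2

/-- **NORMAL-FORM REDUCTION**: for down-sets `K_X, K_Z ∋ ∅`, `Ñ₂(nfX, nfZ) ≤ Ñ₂(K_X, K_Z)` coefficientwise. [this work] -/
theorem coeff_N2gen_nf_le (hKX : IsLowerSet (KX : Set (Finset α))) (hKZ : IsLowerSet (KZ : Set (Finset α))) (h0X : ∅ ∈ KX) (h0Z : ∅ ∈ KZ)
    (n : α →₀ ℕ) : (N2gen (nfX KX KZ) (nfZ KX KZ)).coeff n ≤ (N2gen KX KZ).coeff n := by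
  have step1 : (N2gen (nfX KX KZ) KZ).coeff n ≤ (N2gen KX KZ).coeff n :=
    coeff_N2gen_antitone_left hKZ _ KX (nfX KX KZ) rfl (subset_nfX hKX) (nfX_diff h0X hKZ) n
  have step2 : (N2gen (nfX KX KZ) (nfZ KX KZ)).coeff n ≤ (N2gen (nfX KX KZ) KZ).coeff n :=
    coeff_N2gen_antitone_right (isLowerSet_flagCx _ _) (subset_nfZ hKZ) (nfZ_diff h0Z) n
  exact step2.trans step1

end nf

/-- **Reduction to flag configurations.**  If `Ñ₂ ∈ ℕ[r]` for every flag configuration `(Fl(L_X, priv ∪ A), Fl(L_Z, priv ∪ B))` with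
`L_X ∪ L_Z = univ` and `A, B ⊆ pairs(L_X ∩ L_Z) ⊆ A ∪ B`, then `Ñ₂(K_X, K_Z) ∈ ℕ[r]` for every pair of down-sets containing `∅`. [this work] -/
theorem coeff_N2gen_nonneg_of_configs
    (h : ∀ (LX LZ : Finset α) (A B : Finset (Finset α)), LX ∪ LZ = univ → A ⊆ pairsIn (LX ∩ LZ) → B ⊆ pairsIn (LX ∩ LZ) →
      pairsIn (LX ∩ LZ) ⊆ A ∪ B → ∀ n, 0 ≤ (N2gen (flagCx LX (privPairs LX LZ ∪ A)) (flagCx LZ (privPairs LZ LX ∪ B))).coeff n)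
    {KX KZ : Finset (Finset α)} (hKX : IsLowerSet (KX : Set (Finset α))) (hKZ : IsLowerSet (KZ : Set (Finset α)))
    (h0X : ∅ ∈ KX) (h0Z : ∅ ∈ KZ) (n : α →₀ ℕ) : 0 ≤ (N2gen KX KZ).coeff n := by
  obtain ⟨h1, h2, h3, h4⟩ := nf_valid KX KZ
  exact (h _ _ _ _ h1 h2 h3 h4 n).trans (coeff_N2gen_nf_le hKX hKZ h0X h0Z n)

end Summit.CriticalPhenomena.PercolationContinuityZ3.Theorems.SahiCTCForms
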